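import Summits.ResolutionOfSingularities.ResolutionOfSingularities.Theorems.EquisingularLiftEquisingularLiftNatResidueHypDefs5
import HarnessLib

/-!
# [OURS · L1 W4.5(b) · EL♮(3) · NOSE] THE ν2 SCHEMA — `NoseHypPointsFirstBTriplePrime` from ONE E1-legal point step and ONE nose move with an EMPTY B‴ chain

res-L1-w45b-nose-w2 g2 (WIDTH seat on D-0157 DOOR 1, nose row; (N0)/(N4) owner; brick (A) of the «STEINER ∈ ν2 at scheme level» line announced
2026-08-28T18:44Z on the cell bus (STATUS l.≈82773)). OURS; NOT a statement of any manuscript ([Hironaka2017] is a candidate under adjudication, nothing of it is asserted);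
AI-written, weaker than expert review. PURE LOGIC over the (N0) definitions ✓ p648428 (`…NatResidueHypDefs5`: `ReachPtNoseBTriplePrime`,
`NoseHypPointsFirstBTriplePrime`); no `sorry`, no definition, no instance, no notation; standard axioms. `--kind proof --supports
stmt-ResolutionOfSingularities-20148 --as helper`; closes nothing. Resolution of singularities in positive characteristic is NOT proved here or anywhere in this
chain (dimension 3 is Cossart–Piltant 2008/2009 in print); EL♮(3) is NOT proved by this file.

WHY. The 36th registration's hypothesis (H-ν2) `NoseHypPointsFirstBTriplePrime k n H ι` («POINTS FIRST, then an UNOBSTRUCTED nose, then B‴»; rung (R-ν2)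
✓ p649915) reads `∃ F' ρ' T', (∀ Q, Q base → Q closed under {point step, nose move hung off a point step} → Q F' ρ' T') ∧ (closure T')~ regular`: the final
stage must be chosen BEFORE the motive `Q` (Q-UNIFORM). Its first named customer (NOSE WORD v1 §3 row 1: Steiner's Roman surface, verdict «Steiner ∈ ν2» by
res-L1-w45b-nose-w3, `STEINER-TEST.md`) is reached by an EXPLICIT tower: ONE point step at the triple point, ONE nose move at the three disjoint strict-transform lines
with an EMPTY B‴ round phase (one blow-up of the nose resolves). This file is the plumbing of exactly that shape, ONCE, so that a specimen supplies only geometry: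

* §1 `reachPtNoseBTriplePrime_of_oneBlowup` — the ZERO-ROUND nose move: nose data `(Z, hZ, …, DirStepUnobs F₂ univ _ Z hZ)` at the stage `F₂` and ANY blow-up
  `υ' : F₃ ⟶ F₂` of `𝓘⟨Z⟩` give `ReachPtNoseBTriplePrime F₁ F₂ υ x T₂ F₃ υ' (closure (υ'⁻¹(T₂ ∖ Z)))` (B‴ chain = the seed, `γ' = 𝟙`, `E' = υ'⁻¹ Z`, `Es' = Ns' = []`,
  `K' = ∅`) — the ν2 twin of res-L1-w45b-nose-w3's ✓ `reachNoseTowerBTriplePrime_of_oneBlowup` (p642717) and res-L1-w45b-nose-w1's `noseHypUnobsBTriplePrime_of_oneBlowup`.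
* §2 `noseHypPointsFirstBTriplePrime_of_reach_pointStep_move` — from ANY Q-uniformly reachable stage `(F₁, ρ, T₁)` (spelled out: every motive holding at the base and
  closed under the two moves holds there), ONE E1-legal point step `υ` at a point `x` of `T̂₁` (closed in `F₁`, NON-regular on `T̂₁`, regular on `F₁`, `IsBlowup υ 𝓘{x}`)
  followed by ONE nose move `ReachPtNoseBTriplePrime F₁ F₂ υ x (St T₁) F₉ β T₉` whose end has a regular reduced strict transform gives (H-ν2); the initial-stage
  instance `noseHypPointsFirstBTriplePrime_of_pointStep_move` (`F₁ = ℙⁿ_k`, `ρ = 𝟙`, `T₁ = range ι`); and the reachability bookkeeping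
  `reach_pointStep` / `reach_move` (explicit towers of any length stay Q-uniform; the base case is the identity).
* §3 `noseHypPointsFirstBTriplePrime_of_pointStep_oneBlowup` — §1 ∘ §2: one point step at the initial stage, nose data one floor up, one blow-up of the nose,
  `(closure υ'⁻¹(St ∖ Z))~` regular ⇒ `NoseHypPointsFirstBTriplePrime k n H ι`. This is the socket the Steiner certificate (bricks (B)/(C)) plugs into.

HONEST SCOPE: res-L1-w45b-nose-w2 g0's points-first prefix ✓ p646582 (`exists_pointSteps_regularise_singularCurve`) is stated PER MOTIVE (`∀ Q, … ∃ stage`), which is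
the right shape for the rung's HSUB but does NOT by itself produce (H-ν2)'s Q-uniform `∃ stage, ∀ Q`; explicit towers (this file) do. Nothing here decides any
`DirStepUnobs` or regularity clause — those are the specimen's.
-/

set_option linter.dupNamespace false -- mandated namespace `Summit.<Summit>.<Problem>` of this single-conjunct summit

noncomputable section

open CategoryTheory CategoryTheory.Limits AlgebraicGeometry TopologicalSpace Topology IsLocalRing
open Literature.AlgebraicGeometry.Resolution
open AlgebraicGeometry.Scheme.IdealSheafData

namespace Summit.ResolutionOfSingularities.ResolutionOfSingularities.Cruxes.EquisingularLiftNat.Sections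

/-! ## §1 The zero-round nose move one floor up -/

/-- **THE ZERO-ROUND NOSE MOVE (ν2).** At a stage `F₂` (hung off any point step `(F₁, υ, x)`; those binders are not read), nose data — a closed `Z ⊆ T₂` with
`T₂ ⊄ Z`, `Z` infinite, the curve clause, `Z̃` regular, the ambient regular along `Z̃`, `DirStepUnobs F₂ univ _ Z hZ` — together with ANY blow-up `υ' : F₃ ⟶ F₂`
of `𝓘⟨Z⟩` give the nose move `ReachPtNoseBTriplePrime F₁ F₂ υ x T₂ F₃ υ' (closure (υ'⁻¹(T₂ ∖ Z)))` with the EMPTY B‴ chain (the seed itself: `γ' = 𝟙`,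
`E' = υ'⁻¹ Z`, no boundary lists, `K' = ∅`). [OURS · L1 W4.5b · pure logic over (N0) p648428] -/
theorem reachPtNoseBTriplePrime_of_oneBlowup (F₁ F₂ : Scheme.{0}) (υ : F₂ ⟶ F₁) (x : F₁) (T₂ : Set F₂)
    (Z : Set F₂) (hZ : IsClosed Z) (hZT : Z ⊆ T₂) (hTZ : ¬ (T₂ ⊆ Z)) (hZinf : Z.Infinite)
    (hcurve : ∀ z : ↥(redSub F₂ Z hZ), IsClosed ({z} : Set ↥(redSub F₂ Z hZ)) →
      ringKrullDim ((redSub F₂ Z hZ).presheaf.stalk z) = ((1 : ℕ) : WithBot ℕ∞))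
    (hZreg : ∀ x : redSub F₂ Z hZ, IsRegularLocalRing ((redSub F₂ Z hZ).presheaf.stalk x))
    (hamb : ∀ (i : redSub F₂ Z hZ ⟶ redSub F₂ Set.univ isClosed_univ), i ≫ redSubι F₂ Set.univ isClosed_univ = redSubι F₂ Z hZ →
      ∀ x : redSub F₂ Z hZ, IsRegularLocalRing ((redSub F₂ Set.univ isClosed_univ).presheaf.stalk (i x)))
    (hunobs : DirStepUnobs F₂ Set.univ isClosed_univ Z hZ)
    (F₃ : Scheme.{0}) (υ' : F₃ ⟶ F₂) (hυ' : IsBlowup υ' (vanishingIdeal (⟨Z, hZ⟩ : Closeds F₂))) :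
    ReachPtNoseBTriplePrime F₁ F₂ υ x T₂ F₃ υ' (closure (υ' ⁻¹' (T₂ \ Z))) := by
  refine ⟨Z, hZ, hZT, hTZ, hZinf, hcurve, hZreg, hamb, hunobs, F₃, υ', hυ', 𝟙 F₃, υ' ⁻¹' Z, [], [], ∅, ?_, (Category.id_comp υ').symm⟩
  intro R hseed _ _ _
  exact hseed

/-! ## §2 One point step + one nose move, Q-uniformly -/

/-- **(H-ν2) FROM A REACHABLE STAGE, ONE POINT STEP AND ONE NOSE MOVE.** Let `(F₁, ρ, T₁)` be a stage reached Q-UNIFORMLY from `(ℙⁿ_k, 𝟙, range ι)` (every motive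
`Q` holding at the base and closed under the chains' point step and under the nose move hung off a point step holds at `(F₁, ρ, T₁)`), `x` a point of the reduced
closure `T̂₁` which is closed in `F₁`, NON-regular on `T̂₁` and regular on `F₁`, `υ : F₂ ⟶ F₁` a blow-up of `𝓘{x}` (the E1-legal point step), and
`ReachPtNoseBTriplePrime F₁ F₂ υ x (closure υ⁻¹(T₁ ∖ {x})) F₉ β T₉` a nose move hung off it whose end `(F₉, T₉)` has a REGULAR reduced strict transform
`(closure T₉)~`. Then `NoseHypPointsFirstBTriplePrime k n H ι`, with the Q-uniform witness `(F₉, (β ≫ υ) ≫ ρ, T₉)`. [OURS · L1 W4.5b · pure logic over (N0) p648428] -/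
theorem noseHypPointsFirstBTriplePrime_of_reach_pointStep_move (k : Type) [Field k] [IsAlgClosed k] (n : ℕ) (H : Scheme.{0})
    (ι : H ⟶ (Literature.AlgebraicGeometry.Motives.projectiveSpace n k).left)
    (F₁ : Scheme.{0}) (ρ : F₁ ⟶ (Literature.AlgebraicGeometry.Motives.projectiveSpace n k).left) (T₁ : Set F₁)
    (hreach : ∀ Q : (∀ F : Scheme.{0}, (F ⟶ (Literature.AlgebraicGeometry.Motives.projectiveSpace n k).left) → Set F → Prop),
      Q (Literature.AlgebraicGeometry.Motives.projectiveSpace n k).left (𝟙 _) (Set.range ι) →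
      (∀ (G₁ G₂ : Scheme.{0}) (σ : G₁ ⟶ (Literature.AlgebraicGeometry.Motives.projectiveSpace n k).left) (S₁ : Set G₁)
          (y : ↥(vanishingIdeal (⟨closure S₁, isClosed_closure⟩ : Closeds G₁)).subscheme) (τ : G₂ ⟶ G₁)
          (hy : IsClosed ({((vanishingIdeal (⟨closure S₁, isClosed_closure⟩ : Closeds G₁)).subschemeι y : G₁)} : Set G₁)),
        Q G₁ σ S₁ →
        ¬ IsRegularLocalRing ((vanishingIdeal (⟨closure S₁, isClosed_closure⟩ : Closeds G₁)).subscheme.presheaf.stalk y) →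
        IsRegularLocalRing (G₁.presheaf.stalk ((vanishingIdeal (⟨closure S₁, isClosed_closure⟩ : Closeds G₁)).subschemeι y)) →
        IsBlowup τ (vanishingIdeal
          (⟨{((vanishingIdeal (⟨closure S₁, isClosed_closure⟩ : Closeds G₁)).subschemeι y : G₁)}, hy⟩ : Closeds G₁)) →
        Q G₂ (τ ≫ σ) (closure (τ ⁻¹' (S₁ \ {((vanishingIdeal (⟨closure S₁, isClosed_closure⟩ : Closeds G₁)).subschemeι y : G₁)}))) ∧
        (∀ (G₉ : Scheme.{0}) (β : G₉ ⟶ G₂) (S₉ : Set G₉),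
          ReachPtNoseBTriplePrime G₁ G₂ τ ((vanishingIdeal (⟨closure S₁, isClosed_closure⟩ : Closeds G₁)).subschemeι y)
            (closure (τ ⁻¹' (S₁ \ {((vanishingIdeal (⟨closure S₁, isClosed_closure⟩ : Closeds G₁)).subschemeι y : G₁)}))) G₉ β S₉ →
          Q G₉ ((β ≫ τ) ≫ σ) S₉)) →
      Q F₁ ρ T₁)
    (x : ↥(vanishingIdeal (⟨closure T₁, isClosed_closure⟩ : Closeds F₁)).subscheme)
    (hx : IsClosed ({((vanishingIdeal (⟨closure T₁, isClosed_closure⟩ : Closeds F₁)).subschemeι x : F₁)} : Set F₁))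
    (hxT : ¬ IsRegularLocalRing ((vanishingIdeal (⟨closure T₁, isClosed_closure⟩ : Closeds F₁)).subscheme.presheaf.stalk x))
    (hxF : IsRegularLocalRing (F₁.presheaf.stalk ((vanishingIdeal (⟨closure T₁, isClosed_closure⟩ : Closeds F₁)).subschemeι x)))
    (F₂ : Scheme.{0}) (υ : F₂ ⟶ F₁)
    (hυ : IsBlowup υ (vanishingIdeal
      (⟨{((vanishingIdeal (⟨closure T₁, isClosed_closure⟩ : Closeds F₁)).subschemeι x : F₁)}, hx⟩ : Closeds F₁)))
    (F₉ : Scheme.{0}) (β : F₉ ⟶ F₂) (T₉ : Set F₉)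
    (hmove : ReachPtNoseBTriplePrime F₁ F₂ υ ((vanishingIdeal (⟨closure T₁, isClosed_closure⟩ : Closeds F₁)).subschemeι x)
      (closure (υ ⁻¹' (T₁ \ {((vanishingIdeal (⟨closure T₁, isClosed_closure⟩ : Closeds F₁)).subschemeι x : F₁)}))) F₉ β T₉)
    (hfin : Literature.AlgebraicGeometry.Resolution.Scheme.IsRegular
      (vanishingIdeal (⟨closure T₉, isClosed_closure⟩ : Closeds F₉)).subscheme) :
    NoseHypPointsFirstBTriplePrime k n H ι := by
  refine ⟨F₉, (β ≫ υ) ≫ ρ, T₉, ?_, hfin⟩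
  intro Q hQ0 hcl
  exact (hcl F₁ F₂ ρ T₁ x υ hx (hreach Q hQ0 hcl) hxT hxF hυ).2 F₉ β T₉ hmove

/-- **(H-ν2) FROM ONE POINT STEP AT THE INITIAL STAGE AND ONE NOSE MOVE.** The instance `F₁ = ℙⁿ_k`, `ρ = 𝟙`, `T₁ = range ι` of
`noseHypPointsFirstBTriplePrime_of_reach_pointStep_move`: an E1-legal point step `υ : F₂ ⟶ ℙⁿ_k` at a point `x` of `(range ι)^` (closed, non-regular on the
reduced closure, `ℙⁿ` regular there), then a nose move `ReachPtNoseBTriplePrime ℙⁿ F₂ υ x (St) F₉ β T₉` ending at a stage with regular reduced strict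
transform, give `NoseHypPointsFirstBTriplePrime k n H ι` (witness `(F₉, (β ≫ υ) ≫ 𝟙, T₉)`). [OURS · L1 W4.5b · pure logic over (N0) p648428] -/
theorem noseHypPointsFirstBTriplePrime_of_pointStep_move (k : Type) [Field k] [IsAlgClosed k] (n : ℕ) (H : Scheme.{0})
    (ι : H ⟶ (Literature.AlgebraicGeometry.Motives.projectiveSpace n k).left)
    (x : ↥(vanishingIdeal (⟨closure (Set.range ι), isClosed_closure⟩ :
      Closeds (Literature.AlgebraicGeometry.Motives.projectiveSpace n k).left)).subscheme)
    (hx : IsClosed ({((vanishingIdeal (⟨closure (Set.range ι), isClosed_closure⟩ :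
      Closeds (Literature.AlgebraicGeometry.Motives.projectiveSpace n k).left)).subschemeι x :
        (Literature.AlgebraicGeometry.Motives.projectiveSpace n k).left)} :
      Set (Literature.AlgebraicGeometry.Motives.projectiveSpace n k).left))
    (hxT : ¬ IsRegularLocalRing ((vanishingIdeal (⟨closure (Set.range ι), isClosed_closure⟩ :
      Closeds (Literature.AlgebraicGeometry.Motives.projectiveSpace n k).left)).subscheme.presheaf.stalk x))
    (hxF : IsRegularLocalRing ((Literature.AlgebraicGeometry.Motives.projectiveSpace n k).left.presheaf.stalk
      ((vanishingIdeal (⟨closure (Set.range ι), isClosed_closure⟩ :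
        Closeds (Literature.AlgebraicGeometry.Motives.projectiveSpace n k).left)).subschemeι x)))
    (F₂ : Scheme.{0}) (υ : F₂ ⟶ (Literature.AlgebraicGeometry.Motives.projectiveSpace n k).left)
    (hυ : IsBlowup υ (vanishingIdeal
      (⟨{((vanishingIdeal (⟨closure (Set.range ι), isClosed_closure⟩ :
        Closeds (Literature.AlgebraicGeometry.Motives.projectiveSpace n k).left)).subschemeι x :
          (Literature.AlgebraicGeometry.Motives.projectiveSpace n k).left)}, hx⟩ :
        Closeds (Literature.AlgebraicGeometry.Motives.projectiveSpace n k).left)))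
    (F₉ : Scheme.{0}) (β : F₉ ⟶ F₂) (T₉ : Set F₉)
    (hmove : ReachPtNoseBTriplePrime (Literature.AlgebraicGeometry.Motives.projectiveSpace n k).left F₂ υ
      ((vanishingIdeal (⟨closure (Set.range ι), isClosed_closure⟩ :
        Closeds (Literature.AlgebraicGeometry.Motives.projectiveSpace n k).left)).subschemeι x)
      (closure (υ ⁻¹' (Set.range ι \ {((vanishingIdeal (⟨closure (Set.range ι), isClosed_closure⟩ :
        Closeds (Literature.AlgebraicGeometry.Motives.projectiveSpace n k).left)).subschemeι x :
          (Literature.AlgebraicGeometry.Motives.projectiveSpace n k).left)}))) F₉ β T₉)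
    (hfin : Literature.AlgebraicGeometry.Resolution.Scheme.IsRegular
      (vanishingIdeal (⟨closure T₉, isClosed_closure⟩ : Closeds F₉)).subscheme) :
    NoseHypPointsFirstBTriplePrime k n H ι := by
  have h := noseHypPointsFirstBTriplePrime_of_reach_pointStep_move k n H ι
    (Literature.AlgebraicGeometry.Motives.projectiveSpace n k).left (𝟙 _) (Set.range ι) (fun Q hQ0 _ => hQ0)
    x hx hxT hxF F₂ υ hυ F₉ β T₉ hmove hfin
  exact h

/-- **REACHABILITY BOOKKEEPING, point step.** If `(F₁, ρ, T₁)` is reached Q-uniformly, so is the end `(F₂, υ ≫ ρ, closure υ⁻¹(T₁ ∖ {x}))` of an E1-legal point step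
at `x` (closed in `F₁`, non-regular on `T̂₁`, `F₁` regular at `x`, `IsBlowup υ 𝓘{x}`). Explicit towers of any length therefore stay Q-uniform. [OURS · L1 W4.5b ·
pure logic over (N0) p648428] -/
theorem reach_pointStep (k : Type) [Field k] (n : ℕ) (H : Scheme.{0})
    (ι : H ⟶ (Literature.AlgebraicGeometry.Motives.projectiveSpace n k).left)
    (F₁ : Scheme.{0}) (ρ : F₁ ⟶ (Literature.AlgebraicGeometry.Motives.projectiveSpace n k).left) (T₁ : Set F₁)
    (hreach : ∀ Q : (∀ F : Scheme.{0}, (F ⟶ (Literature.AlgebraicGeometry.Motives.projectiveSpace n k).left) → Set F → Prop),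
      Q (Literature.AlgebraicGeometry.Motives.projectiveSpace n k).left (𝟙 _) (Set.range ι) →
      (∀ (G₁ G₂ : Scheme.{0}) (σ : G₁ ⟶ (Literature.AlgebraicGeometry.Motives.projectiveSpace n k).left) (S₁ : Set G₁)
          (y : ↥(vanishingIdeal (⟨closure S₁, isClosed_closure⟩ : Closeds G₁)).subscheme) (τ : G₂ ⟶ G₁)
          (hy : IsClosed ({((vanishingIdeal (⟨closure S₁, isClosed_closure⟩ : Closeds G₁)).subschemeι y : G₁)} : Set G₁)),
        Q G₁ σ S₁ →
        ¬ IsRegularLocalRing ((vanishingIdeal (⟨closure S₁, isClosed_closure⟩ : Closeds G₁)).subscheme.presheaf.stalk y) →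
        IsRegularLocalRing (G₁.presheaf.stalk ((vanishingIdeal (⟨closure S₁, isClosed_closure⟩ : Closeds G₁)).subschemeι y)) →
        IsBlowup τ (vanishingIdeal
          (⟨{((vanishingIdeal (⟨closure S₁, isClosed_closure⟩ : Closeds G₁)).subschemeι y : G₁)}, hy⟩ : Closeds G₁)) →
        Q G₂ (τ ≫ σ) (closure (τ ⁻¹' (S₁ \ {((vanishingIdeal (⟨closure S₁, isClosed_closure⟩ : Closeds G₁)).subschemeι y : G₁)}))) ∧
        (∀ (G₉ : Scheme.{0}) (β : G₉ ⟶ G₂) (S₉ : Set G₉),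
          ReachPtNoseBTriplePrime G₁ G₂ τ ((vanishingIdeal (⟨closure S₁, isClosed_closure⟩ : Closeds G₁)).subschemeι y)
            (closure (τ ⁻¹' (S₁ \ {((vanishingIdeal (⟨closure S₁, isClosed_closure⟩ : Closeds G₁)).subschemeι y : G₁)}))) G₉ β S₉ →
          Q G₉ ((β ≫ τ) ≫ σ) S₉)) →
      Q F₁ ρ T₁)
    (x : ↥(vanishingIdeal (⟨closure T₁, isClosed_closure⟩ : Closeds F₁)).subscheme)
    (hx : IsClosed ({((vanishingIdeal (⟨closure T₁, isClosed_closure⟩ : Closeds F₁)).subschemeι x : F₁)} : Set F₁))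
    (hxT : ¬ IsRegularLocalRing ((vanishingIdeal (⟨closure T₁, isClosed_closure⟩ : Closeds F₁)).subscheme.presheaf.stalk x))
    (hxF : IsRegularLocalRing (F₁.presheaf.stalk ((vanishingIdeal (⟨closure T₁, isClosed_closure⟩ : Closeds F₁)).subschemeι x)))
    (F₂ : Scheme.{0}) (υ : F₂ ⟶ F₁)
    (hυ : IsBlowup υ (vanishingIdeal
      (⟨{((vanishingIdeal (⟨closure T₁, isClosed_closure⟩ : Closeds F₁)).subschemeι x : F₁)}, hx⟩ : Closeds F₁))) :
    ∀ Q : (∀ F : Scheme.{0}, (F ⟶ (Literature.AlgebraicGeometry.Motives.projectiveSpace n k).left) → Set F → Prop),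
      Q (Literature.AlgebraicGeometry.Motives.projectiveSpace n k).left (𝟙 _) (Set.range ι) →
      (∀ (G₁ G₂ : Scheme.{0}) (σ : G₁ ⟶ (Literature.AlgebraicGeometry.Motives.projectiveSpace n k).left) (S₁ : Set G₁)
          (y : ↥(vanishingIdeal (⟨closure S₁, isClosed_closure⟩ : Closeds G₁)).subscheme) (τ : G₂ ⟶ G₁)
          (hy : IsClosed ({((vanishingIdeal (⟨closure S₁, isClosed_closure⟩ : Closeds G₁)).subschemeι y : G₁)} : Set G₁)),
        Q G₁ σ S₁ →
        ¬ IsRegularLocalRing ((vanishingIdeal (⟨closure S₁, isClosed_closure⟩ : Closeds G₁)).subscheme.presheaf.stalk y) →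
        IsRegularLocalRing (G₁.presheaf.stalk ((vanishingIdeal (⟨closure S₁, isClosed_closure⟩ : Closeds G₁)).subschemeι y)) →
        IsBlowup τ (vanishingIdeal
          (⟨{((vanishingIdeal (⟨closure S₁, isClosed_closure⟩ : Closeds G₁)).subschemeι y : G₁)}, hy⟩ : Closeds G₁)) →
        Q G₂ (τ ≫ σ) (closure (τ ⁻¹' (S₁ \ {((vanishingIdeal (⟨closure S₁, isClosed_closure⟩ : Closeds G₁)).subschemeι y : G₁)}))) ∧
        (∀ (G₉ : Scheme.{0}) (β : G₉ ⟶ G₂) (S₉ : Set G₉),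
          ReachPtNoseBTriplePrime G₁ G₂ τ ((vanishingIdeal (⟨closure S₁, isClosed_closure⟩ : Closeds G₁)).subschemeι y)
            (closure (τ ⁻¹' (S₁ \ {((vanishingIdeal (⟨closure S₁, isClosed_closure⟩ : Closeds G₁)).subschemeι y : G₁)}))) G₉ β S₉ →
          Q G₉ ((β ≫ τ) ≫ σ) S₉)) →
      Q F₂ (υ ≫ ρ) (closure (υ ⁻¹' (T₁ \ {((vanishingIdeal (⟨closure T₁, isClosed_closure⟩ : Closeds F₁)).subschemeι x : F₁)}))) := by
  intro Q hQ0 hcl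
  exact (hcl F₁ F₂ ρ T₁ x υ hx (hreach Q hQ0 hcl) hxT hxF hυ).1

/-- **REACHABILITY BOOKKEEPING, nose move.** If `(F₁, ρ, T₁)` is reached Q-uniformly and `υ` is an E1-legal point step at `x` as above, then the end `(F₉, (β ≫ υ) ≫ ρ, T₉)`
of ANY nose move `ReachPtNoseBTriplePrime F₁ F₂ υ x (closure υ⁻¹(T₁ ∖ {x})) F₉ β T₉` hung off it is reached Q-uniformly. [OURS · L1 W4.5b · pure logic over (N0)
p648428] -/
theorem reach_move (k : Type) [Field k] (n : ℕ) (H : Scheme.{0})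
    (ι : H ⟶ (Literature.AlgebraicGeometry.Motives.projectiveSpace n k).left)
    (F₁ : Scheme.{0}) (ρ : F₁ ⟶ (Literature.AlgebraicGeometry.Motives.projectiveSpace n k).left) (T₁ : Set F₁)
    (hreach : ∀ Q : (∀ F : Scheme.{0}, (F ⟶ (Literature.AlgebraicGeometry.Motives.projectiveSpace n k).left) → Set F → Prop),
      Q (Literature.AlgebraicGeometry.Motives.projectiveSpace n k).left (𝟙 _) (Set.range ι) →
      (∀ (G₁ G₂ : Scheme.{0}) (σ : G₁ ⟶ (Literature.AlgebraicGeometry.Motives.projectiveSpace n k).left) (S₁ : Set G₁)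
          (y : ↥(vanishingIdeal (⟨closure S₁, isClosed_closure⟩ : Closeds G₁)).subscheme) (τ : G₂ ⟶ G₁)
          (hy : IsClosed ({((vanishingIdeal (⟨closure S₁, isClosed_closure⟩ : Closeds G₁)).subschemeι y : G₁)} : Set G₁)),
        Q G₁ σ S₁ →
        ¬ IsRegularLocalRing ((vanishingIdeal (⟨closure S₁, isClosed_closure⟩ : Closeds G₁)).subscheme.presheaf.stalk y) →
        IsRegularLocalRing (G₁.presheaf.stalk ((vanishingIdeal (⟨closure S₁, isClosed_closure⟩ : Closeds G₁)).subschemeι y)) →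
        IsBlowup τ (vanishingIdeal
          (⟨{((vanishingIdeal (⟨closure S₁, isClosed_closure⟩ : Closeds G₁)).subschemeι y : G₁)}, hy⟩ : Closeds G₁)) →
        Q G₂ (τ ≫ σ) (closure (τ ⁻¹' (S₁ \ {((vanishingIdeal (⟨closure S₁, isClosed_closure⟩ : Closeds G₁)).subschemeι y : G₁)}))) ∧
        (∀ (G₉ : Scheme.{0}) (β : G₉ ⟶ G₂) (S₉ : Set G₉),
          ReachPtNoseBTriplePrime G₁ G₂ τ ((vanishingIdeal (⟨closure S₁, isClosed_closure⟩ : Closeds G₁)).subschemeι y)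
            (closure (τ ⁻¹' (S₁ \ {((vanishingIdeal (⟨closure S₁, isClosed_closure⟩ : Closeds G₁)).subschemeι y : G₁)}))) G₉ β S₉ →
          Q G₉ ((β ≫ τ) ≫ σ) S₉)) →
      Q F₁ ρ T₁)
    (x : ↥(vanishingIdeal (⟨closure T₁, isClosed_closure⟩ : Closeds F₁)).subscheme)
    (hx : IsClosed ({((vanishingIdeal (⟨closure T₁, isClosed_closure⟩ : Closeds F₁)).subschemeι x : F₁)} : Set F₁))
    (hxT : ¬ IsRegularLocalRing ((vanishingIdeal (⟨closure T₁, isClosed_closure⟩ : Closeds F₁)).subscheme.presheaf.stalk x))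
    (hxF : IsRegularLocalRing (F₁.presheaf.stalk ((vanishingIdeal (⟨closure T₁, isClosed_closure⟩ : Closeds F₁)).subschemeι x)))
    (F₂ : Scheme.{0}) (υ : F₂ ⟶ F₁)
    (hυ : IsBlowup υ (vanishingIdeal
      (⟨{((vanishingIdeal (⟨closure T₁, isClosed_closure⟩ : Closeds F₁)).subschemeι x : F₁)}, hx⟩ : Closeds F₁)))
    (F₉ : Scheme.{0}) (β : F₉ ⟶ F₂) (T₉ : Set F₉)
    (hmove : ReachPtNoseBTriplePrime F₁ F₂ υ ((vanishingIdeal (⟨closure T₁, isClosed_closure⟩ : Closeds F₁)).subschemeι x)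
      (closure (υ ⁻¹' (T₁ \ {((vanishingIdeal (⟨closure T₁, isClosed_closure⟩ : Closeds F₁)).subschemeι x : F₁)}))) F₉ β T₉) :
    ∀ Q : (∀ F : Scheme.{0}, (F ⟶ (Literature.AlgebraicGeometry.Motives.projectiveSpace n k).left) → Set F → Prop),
      Q (Literature.AlgebraicGeometry.Motives.projectiveSpace n k).left (𝟙 _) (Set.range ι) →
      (∀ (G₁ G₂ : Scheme.{0}) (σ : G₁ ⟶ (Literature.AlgebraicGeometry.Motives.projectiveSpace n k).left) (S₁ : Set G₁)
          (y : ↥(vanishingIdeal (⟨closure S₁, isClosed_closure⟩ : Closeds G₁)).subscheme) (τ : G₂ ⟶ G₁)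
          (hy : IsClosed ({((vanishingIdeal (⟨closure S₁, isClosed_closure⟩ : Closeds G₁)).subschemeι y : G₁)} : Set G₁)),
        Q G₁ σ S₁ →
        ¬ IsRegularLocalRing ((vanishingIdeal (⟨closure S₁, isClosed_closure⟩ : Closeds G₁)).subscheme.presheaf.stalk y) →
        IsRegularLocalRing (G₁.presheaf.stalk ((vanishingIdeal (⟨closure S₁, isClosed_closure⟩ : Closeds G₁)).subschemeι y)) →
        IsBlowup τ (vanishingIdeal
          (⟨{((vanishingIdeal (⟨closure S₁, isClosed_closure⟩ : Closeds G₁)).subschemeι y : G₁)}, hy⟩ : Closeds G₁)) →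
        Q G₂ (τ ≫ σ) (closure (τ ⁻¹' (S₁ \ {((vanishingIdeal (⟨closure S₁, isClosed_closure⟩ : Closeds G₁)).subschemeι y : G₁)}))) ∧
        (∀ (G₉ : Scheme.{0}) (β : G₉ ⟶ G₂) (S₉ : Set G₉),
          ReachPtNoseBTriplePrime G₁ G₂ τ ((vanishingIdeal (⟨closure S₁, isClosed_closure⟩ : Closeds G₁)).subschemeι y)
            (closure (τ ⁻¹' (S₁ \ {((vanishingIdeal (⟨closure S₁, isClosed_closure⟩ : Closeds G₁)).subschemeι y : G₁)}))) G₉ β S₉ →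
          Q G₉ ((β ≫ τ) ≫ σ) S₉)) →
      Q F₉ ((β ≫ υ) ≫ ρ) T₉ := by
  intro Q hQ0 hcl
  exact (hcl F₁ F₂ ρ T₁ x υ hx (hreach Q hQ0 hcl) hxT hxF hυ).2 F₉ β T₉ hmove

/-! ## §3 The socket for «one point step, nose one floor up, one blow-up resolves» -/

/-- **(H-ν2) FROM ONE POINT STEP, NOSE DATA ONE FLOOR UP AND ONE RESOLVING BLOW-UP.** At the initial stage `(ℙⁿ_k, 𝟙, range ι)`: an E1-legal point step
`υ : F₂ ⟶ ℙⁿ_k` at `x` (closed, NON-regular on `(range ι)^`, `ℙⁿ` regular at `x`); at `F₂`, nose data `Z ⊆ St := closure υ⁻¹(range ι ∖ {x})` (closed, `St ⊄ Z`,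
infinite, curve clause, `Z̃` regular, `F₂` regular along `Z̃`, `DirStepUnobs F₂ univ _ Z hZ`); a blow-up `υ' : F₃ ⟶ F₂` of `𝓘⟨Z⟩` after which the reduced strict
transform `(closure υ'⁻¹(St ∖ Z))~` is REGULAR. Then `NoseHypPointsFirstBTriplePrime k n H ι` — §1's zero-round move fed to §2. This is the socket of the Steiner
certificate («Steiner ∈ ν2», res-L1-w45b-nose-w3 `STEINER-TEST.md`: `x` = the triple point, `Z` = the three disjoint strict-transform lines, EMPTY B‴ phase).
[OURS · L1 W4.5b · pure logic over (N0) p648428] -/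
theorem noseHypPointsFirstBTriplePrime_of_pointStep_oneBlowup (k : Type) [Field k] [IsAlgClosed k] (n : ℕ) (H : Scheme.{0})
    (ι : H ⟶ (Literature.AlgebraicGeometry.Motives.projectiveSpace n k).left)
    (x : ↥(vanishingIdeal (⟨closure (Set.range ι), isClosed_closure⟩ :
      Closeds (Literature.AlgebraicGeometry.Motives.projectiveSpace n k).left)).subscheme)
    (hx : IsClosed ({((vanishingIdeal (⟨closure (Set.range ι), isClosed_closure⟩ :
      Closeds (Literature.AlgebraicGeometry.Motives.projectiveSpace n k).left)).subschemeι x :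
        (Literature.AlgebraicGeometry.Motives.projectiveSpace n k).left)} :
      Set (Literature.AlgebraicGeometry.Motives.projectiveSpace n k).left))
    (hxT : ¬ IsRegularLocalRing ((vanishingIdeal (⟨closure (Set.range ι), isClosed_closure⟩ :
      Closeds (Literature.AlgebraicGeometry.Motives.projectiveSpace n k).left)).subscheme.presheaf.stalk x))
    (hxF : IsRegularLocalRing ((Literature.AlgebraicGeometry.Motives.projectiveSpace n k).left.presheaf.stalk
      ((vanishingIdeal (⟨closure (Set.range ι), isClosed_closure⟩ :
        Closeds (Literature.AlgebraicGeometry.Motives.projectiveSpace n k).left)).subschemeι x)))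
    (F₂ : Scheme.{0}) (υ : F₂ ⟶ (Literature.AlgebraicGeometry.Motives.projectiveSpace n k).left)
    (hυ : IsBlowup υ (vanishingIdeal
      (⟨{((vanishingIdeal (⟨closure (Set.range ι), isClosed_closure⟩ :
        Closeds (Literature.AlgebraicGeometry.Motives.projectiveSpace n k).left)).subschemeι x :
          (Literature.AlgebraicGeometry.Motives.projectiveSpace n k).left)}, hx⟩ :
        Closeds (Literature.AlgebraicGeometry.Motives.projectiveSpace n k).left)))
    (Z : Set F₂) (hZ : IsClosed Z)
    (hZT : Z ⊆ closure (υ ⁻¹' (Set.range ι \ {((vanishingIdeal (⟨closure (Set.range ι), isClosed_closure⟩ :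
        Closeds (Literature.AlgebraicGeometry.Motives.projectiveSpace n k).left)).subschemeι x :
          (Literature.AlgebraicGeometry.Motives.projectiveSpace n k).left)})))
    (hTZ : ¬ (closure (υ ⁻¹' (Set.range ι \ {((vanishingIdeal (⟨closure (Set.range ι), isClosed_closure⟩ :
        Closeds (Literature.AlgebraicGeometry.Motives.projectiveSpace n k).left)).subschemeι x :
          (Literature.AlgebraicGeometry.Motives.projectiveSpace n k).left)})) ⊆ Z))
    (hZinf : Z.Infinite)
    (hcurve : ∀ z : ↥(redSub F₂ Z hZ), IsClosed ({z} : Set ↥(redSub F₂ Z hZ)) →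
      ringKrullDim ((redSub F₂ Z hZ).presheaf.stalk z) = ((1 : ℕ) : WithBot ℕ∞))
    (hZreg : ∀ x : redSub F₂ Z hZ, IsRegularLocalRing ((redSub F₂ Z hZ).presheaf.stalk x))
    (hamb : ∀ (i : redSub F₂ Z hZ ⟶ redSub F₂ Set.univ isClosed_univ), i ≫ redSubι F₂ Set.univ isClosed_univ = redSubι F₂ Z hZ →
      ∀ x : redSub F₂ Z hZ, IsRegularLocalRing ((redSub F₂ Set.univ isClosed_univ).presheaf.stalk (i x)))
    (hunobs : DirStepUnobs F₂ Set.univ isClosed_univ Z hZ)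
    (F₃ : Scheme.{0}) (υ' : F₃ ⟶ F₂) (hυ' : IsBlowup υ' (vanishingIdeal (⟨Z, hZ⟩ : Closeds F₂)))
    (hfin : Literature.AlgebraicGeometry.Resolution.Scheme.IsRegular
      (vanishingIdeal (⟨closure (υ' ⁻¹' (closure (υ ⁻¹' (Set.range ι \
        {((vanishingIdeal (⟨closure (Set.range ι), isClosed_closure⟩ :
          Closeds (Literature.AlgebraicGeometry.Motives.projectiveSpace n k).left)).subschemeι x :
            (Literature.AlgebraicGeometry.Motives.projectiveSpace n k).left)})) \ Z)), isClosed_closure⟩ : Closeds F₃)).subscheme) :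
    NoseHypPointsFirstBTriplePrime k n H ι := by
  have hmove := reachPtNoseBTriplePrime_of_oneBlowup _ F₂ υ
    ((vanishingIdeal (⟨closure (Set.range ι), isClosed_closure⟩ :
      Closeds (Literature.AlgebraicGeometry.Motives.projectiveSpace n k).left)).subschemeι x)
    _ Z hZ hZT hTZ hZinf hcurve hZreg hamb hunobs F₃ υ' hυ'
  refine noseHypPointsFirstBTriplePrime_of_pointStep_move k n H ι x hx hxT hxF F₂ υ hυ F₃ υ' _ hmove ?_
  have hC : (⟨closure (closure (υ' ⁻¹' (closure (υ ⁻¹' (Set.range ι \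
      {((vanishingIdeal (⟨closure (Set.range ι), isClosed_closure⟩ :
        Closeds (Literature.AlgebraicGeometry.Motives.projectiveSpace n k).left)).subschemeι x :
          (Literature.AlgebraicGeometry.Motives.projectiveSpace n k).left)})) \ Z))), isClosed_closure⟩ : Closeds F₃) =
      ⟨closure (υ' ⁻¹' (closure (υ ⁻¹' (Set.range ι \
      {((vanishingIdeal (⟨closure (Set.range ι), isClosed_closure⟩ :
        Closeds (Literature.AlgebraicGeometry.Motives.projectiveSpace n k).left)).subschemeι x :
          (Literature.AlgebraicGeometry.Motives.projectiveSpace n k).left)})) \ Z)), isClosed_closure⟩ :=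
    Closeds.ext closure_closure
  rw [hC]
  exact hfin

end Summit.ResolutionOfSingularities.ResolutionOfSingularities.Cruxes.EquisingularLiftNat.Sections

end
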